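import Summits.Ventures.PercRepro.C026CHub
import Summits.Ventures.PercRepro.C026FreeStep

/-!
# C-026 when the neighbourhood of `b` (or of `a`) is hub-like (p5, gen 9; mine-3's Theorem″)

**Theorem** (`c026_bHub`): C-026 holds at every `p ∈ [0,1]^E` on every marked multigraph in which
every non-mark neighbour of `b` is adjacent only to the marks — p1's family `IsMarkHubGraph a b c b`
(`C026HubFamilyExt.lean`); the rest of the graph (around `a` and `c`) is arbitrary.  By the `a ↔ b`
symmetry of C-026 (`law3_swap`) the same holds when the neighbourhood of `a` is hub-like
(`c026_aHub`), and with `c026_cHub` (`C026CHub.lean`): **C-026 holds on every multigraph in which at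
least one of the three marks has a hub-like neighbourhood** (`c026_of_mark_hubLike`).

Proof.  As for Theorem′, p1's family induction (`c026_bHub_of_reduced`) reduces the statement to
`#Bot₃ ≤ #(ac|b) + #(bc|a)` on a simple member with distinct marks.  Here the cluster `L` of `b` is
the star `{b} ∪ {b-hubs with open b-edge}` while `K` and `M` are arbitrary — and the cut tree
`δ(ω) = ω Δ (E[M] ∪ (E[L] ∖ E[K]))` dissolves `L`: in `δ(ω)` the vertex `b` is joined only to `c`
(through a `bc`-edge), to the `b`-hubs of `M` and to the isolated `b`-hubs.  Hence, in `bot`,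
`a ~ b` in `δ(ω)` forces Case 1 (a hub with an open `c`-edge and edges to `a` and `b`) or `c ~ b`
(a `bc`-edge, or an isolated hub with `c`- and `b`-edges) — `IsBot.not_conn_cutSwap_of_not_ctoB_b`,
a closed-boundary argument on the `b`-side set `{b} ∪ {b-hubs with an open c-edge or no open edge}`
— and the three maps `phi1` / «open the `bc`-edge» / `phi3` of `C026HubC.lean` with their decoders
give the bound exactly as in `C026CHub.lean` (`IsMarkHubGraph.bot3_card_le_b`).
-/

namespace PercRepro

open Finset

namespace MultiGraph

variable {V E : Type*} {G : MultiGraph V E}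

section BHub

variable {a b c : V} {ω : Config E}

/-- In the family `IsMarkHubGraph a b c m`, a non-mark with an edge to the mark `m` is hub-like. -/
theorem IsMarkHubGraph.isHubLike_of_link_mark {m : V} (hG : G.IsMarkHubGraph a b c m) {h : V}
    (hh : IsHubV a b c h) {e : E} (hl : G.Link e h m) : G.IsHubLike a b c h := by
  have hm : ¬ IsMark a b c h := fun hm => by
    rcases hm with hm | hm | hm
    · exact hh.1 hm
    · exact hh.2.1 hm
    · exact hh.2.2 hm
  rcases hl with ⟨h1, h2⟩ | ⟨h1, h2⟩
  · have := (hG e).2 h2 (by rw [h1]; exact hm)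
    rwa [h1] at this
  · have := (hG e).1 h1 (by rw [h2]; exact hm)
    rwa [h2] at this

/-- **Without Case 1 and without `c ~ b`, `a ≁ b` in `δ(ω)` when the neighbourhood of `b` is
hub-like**: the set `{b} ∪ {b-hubs with an open c-edge or no open edge}` has a closed δ-boundary
and misses `a`. -/
theorem IsBot.not_conn_cutSwap_of_not_ctoB_b (hG : G.IsMarkHubGraph a b c b) (hs : G.IsSimple)
    (hab : a ≠ b) (hbc : b ≠ c) (hbot : G.IsBot ω a b c)
    (h1 : ¬ G.Case1 ω a b c) (hB : ¬ G.CtoB ω a b c) :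
    ¬ G.Conn (G.cutSwap a b c ω) a b := by
  intro hconn
  have hX := G.mem_of_conn_of_closed_boundary
    (X := {x | x = b ∨ (IsHubV a b c x ∧ G.HasEdge x b ∧ (G.OpenTo ω x c ∨ G.NoOpen ω a b c x))})
    (closed_boundary_of_link fun e he x y hl hx => ?_) (Or.inl rfl) hconn.symm
  · rcases hX with h | ⟨h, -⟩
    · exact hab h
    · exact h.1 rfl
  simp only [Set.mem_setOf_eq] at hx ⊢
  rcases hx with hxb | ⟨hxh, hxb, hxo⟩
  · -- `x = b`: the δ-open edges at `b` go to `c` (excluded) or to a hub-like `y` of `M` or isolated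
    rw [hxb] at hl
    have hyb : y ≠ b := by
      rintro rfl
      exact hs.1 e (by rcases hl with ⟨h1, h2⟩ | ⟨h1, h2⟩ <;> rw [h1, h2])
    by_cases hya : y = a
    · -- the `ab`-edge is closed in `bot` and not flipped
      exfalso
      rw [hya] at hl
      have h0 : ω e = false := by
        cases h' : ω e
        · rfl
        · exact absurd ⟨e, h', hl⟩
            (hbot.not_openTo_marks (Or.inr (Or.inl rfl)) (Or.inl rfl) hab.symm)
      have hmem : e ∉ G.swapSetC ω a b c := by
        rw [mem_swapSetC, hl.mem_edgesAt_iff, hl.mem_edgesAt_iff, hl.mem_edgesAt_iff]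
        simp only [mem_cluster]
        rintro ((h' | h') | ⟨-, h'⟩)
        · exact hbot.2.2 h'.symm
        · exact hbot.2.1 h'.symm
        · exact h' (Or.inr (Conn.refl G ω a))
      rw [G.cutSwap_apply_of_notMem hmem, h0] at he
      exact Bool.noConfusion he
    by_cases hyc : y = c
    · exfalso
      rw [hyc] at hl
      exact hB (Or.inl ⟨e, hl⟩)
    have hy : IsHubV a b c y := ⟨hya, hyb, hyc⟩
    by_cases hoc : G.OpenTo ω y c
    · exact Or.inr ⟨hy, ⟨e, hl.symm⟩, Or.inl hoc⟩
    by_cases hoa : G.OpenTo ω y a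
    · -- `y ∈ K`: the edge `b–y` is closed and not flipped (it is at `K`, not at `M`)
      exfalso
      have h0 : ω e = false := by
        cases h' : ω e
        · rfl
        · exact (hbot.openTo_unique (Or.inl rfl) (Or.inr (Or.inl rfl)) hab hoa
            ⟨e, h', hl.symm⟩).elim
      have hmem : e ∉ G.swapSetC ω a b c := by
        rw [mem_swapSetC, hl.mem_edgesAt_iff, hl.mem_edgesAt_iff, hl.mem_edgesAt_iff]
        simp only [mem_cluster]
        rintro ((h' | h') | ⟨-, h'⟩)
        · exact hbot.2.2 h'.symm
        · exact hbot.2.1 (h'.trans hoa.conn).symm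
        · exact h' (Or.inr hoa.conn.symm)
      rw [G.cutSwap_apply_of_notMem hmem, h0] at he
      exact Bool.noConfusion he
    by_cases hob : G.OpenTo ω y b
    · -- `y ∈ L`: the edge `b–y` is its open edge, flipped (at `L`, not at `K`): closed in `δ(ω)`
      exfalso
      have h0 : ω e = true := (openTo_iff_of_link hs hl.symm ω).1 hob
      have hmem : e ∈ G.swapSetC ω a b c := by
        rw [mem_swapSetC, hl.mem_edgesAt_iff, hl.mem_edgesAt_iff, hl.mem_edgesAt_iff]
        simp only [mem_cluster]
        refine Or.inr ⟨Or.inl (Conn.refl G ω b), ?_⟩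
        rintro (h' | h')
        · exact hbot.1 h'
        · exact hbot.1 (h'.trans hob.conn)
      rw [G.cutSwap_apply_of_mem hmem, h0] at he
      exact Bool.noConfusion he
    · exact Or.inr ⟨hy, ⟨e, hl.symm⟩, Or.inr ⟨hoa, hob, hoc⟩⟩
  · -- `x` is a `b`-hub with an open `c`-edge or no open edge: its neighbours are marks
    have hxhub : G.IsHubLike a b c x := by
      obtain ⟨g, hg⟩ := hxb
      exact hG.isHubLike_of_link_mark hxh hg
    rcases hxhub.mark_of_link hl with hya | hyb | hyc
    · -- `y = a`: Case 1 if `x ∈ M`; a closed, unflipped edge if `x` is isolated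
      exfalso
      rw [hya] at hl
      rcases hxo with hxc | hno
      · exact h1 ⟨x, hxh, hxc, ⟨e, hl⟩, hxb⟩
      · have h0 : ω e = false := by
          cases h' : ω e
          · rfl
          · exact absurd ⟨e, h', hl⟩ hno.1
        have hmem : e ∉ G.swapSetC ω a b c := by
          rw [mem_swapSetC, hl.mem_edgesAt_iff, hl.mem_edgesAt_iff, hl.mem_edgesAt_iff]
          simp only [mem_cluster]
          rintro ((h' | h') | ⟨-, h'⟩)
          · exact hxh.2.2 (hxhub.eq_of_conn_of_noOpen hno h'.symm).symm
          · exact hbot.2.1 h'.symm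
          · exact h' (Or.inr (Conn.refl G ω a))
        rw [G.cutSwap_apply_of_notMem hmem, h0] at he
        exact Bool.noConfusion he
    · exact Or.inl hyb
    · -- `y = c`: the open `c`-edge is closed in `δ(ω)`; an isolated hub with a `c`-edge is Case 2
      exfalso
      rw [hyc] at hl
      rcases hxo with hxc | hno
      · exact (cutSwap_link_hc hs hl).1 he hxc
      · exact hB (Or.inr ⟨x, hxh, hno, ⟨e, hl⟩, hxb⟩)

open Classical in
/-- **`#Bot₃ ≤ #(ac|b) + #(bc|a)` on a simple graph with distinct marks whose neighbourhood of `b`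
is hub-like**: Case 1 injects into `ac|b`, the rest into `bc|a`. -/
theorem IsMarkHubGraph.bot3_card_le_b [Fintype E] [DecidableEq E]
    (hG : G.IsMarkHubGraph a b c b) (hs : G.IsSimple) (hab : a ≠ b) (hac : a ≠ c) (hbc : b ≠ c) :
    (Finset.univ.filter fun ω : Config E => G.Bot3 ω a b c).card ≤
      (Finset.univ.filter fun ω : Config E => G.Conn ω a c ∧ ¬ G.Conn ω a b).card +
        (Finset.univ.filter fun ω : Config E => G.Conn ω b c ∧ ¬ G.Conn ω a b).card := by
  set S := Finset.univ.filter fun ω : Config E => G.Bot3 ω a b c with hS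
  have hsplit := Finset.card_filter_add_card_filter_not (s := S) (p := fun ω => G.Case1 ω a b c)
  have hmem : ∀ ω ∈ S, G.IsBot ω a b c ∧ (G.Case1 ω a b c ∨ G.CtoB ω a b c) := by
    intro ω hω
    obtain ⟨hbot, hconn⟩ := (Finset.mem_filter.1 hω).2
    refine ⟨hbot, ?_⟩
    by_contra h
    push Not at h
    exact hbot.not_conn_cutSwap_of_not_ctoB_b hG hs hab hbc h.1 h.2 hconn
  have h1 : (S.filter fun ω => G.Case1 ω a b c).card ≤
      (Finset.univ.filter fun ω : Config E => G.Conn ω a c ∧ ¬ G.Conn ω a b).card := by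
    refine Finset.card_le_card_of_injOn (G.phi1 a b c) (fun ω hω => ?_) (fun ω hω ω' hω' heq => ?_)
    · obtain ⟨hω, hc⟩ := Finset.mem_filter.1 hω
      exact Finset.mem_filter.2 ⟨Finset.mem_univ _, G.phi1_mem' (hmem ω hω).1 hc⟩
    · obtain ⟨hω, hc⟩ := Finset.mem_filter.1 hω
      obtain ⟨hω', hc'⟩ := Finset.mem_filter.1 hω'
      rw [← closeA_phi1 hac (hmem ω hω).1 hc, ← closeA_phi1 hac (hmem ω' hω').1 hc', heq]
  have h2 : (S.filter fun ω => ¬ G.Case1 ω a b c).card ≤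
      (Finset.univ.filter fun ω : Config E => G.Conn ω b c ∧ ¬ G.Conn ω a b).card := by
    by_cases hbc' : G.HasEdge b c
    · obtain ⟨e₀, hl⟩ := hbc'
      refine Finset.card_le_card_of_injOn (fun ω => Function.update ω e₀ true)
        (fun ω hω => ?_) (fun ω hω ω' hω' heq => ?_)
      · obtain ⟨hω, -⟩ := Finset.mem_filter.1 hω
        exact Finset.mem_filter.2 ⟨Finset.mem_univ _, G.phi2_mem' (hmem ω hω).1 hl⟩
      · obtain ⟨hω, -⟩ := Finset.mem_filter.1 hω
        obtain ⟨hω', -⟩ := Finset.mem_filter.1 hω'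
        have heq' : Function.update ω e₀ true = Function.update ω' e₀ true := heq
        rw [← update_bc_inv hbc (hmem ω hω).1 hl, ← update_bc_inv hbc (hmem ω' hω').1 hl, heq']
    · have hiso : ∀ ω ∈ S, ¬ G.Case1 ω a b c → G.Case2Iso ω a b c := by
        intro ω hω hc
        rcases (hmem ω hω).2 with h | h | h
        · exact absurd h hc
        · exact absurd h hbc'
        · exact h
      refine Finset.card_le_card_of_injOn (G.phi3 a b c) (fun ω hω => ?_)
        (fun ω hω ω' hω' heq => ?_)
      · obtain ⟨hω, hc⟩ := Finset.mem_filter.1 hω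
        refine Finset.mem_filter.2 ⟨Finset.mem_univ _,
          G.phi3_mem_of_isHubLike hbc (hmem ω hω).1 (hiso ω hω hc) ?_⟩
        exact hG.isHubLike_of_link_mark (case2Hub_spec (hiso ω hω hc)).1
          (case2Hub_spec (hiso ω hω hc)).2.2.2
      · obtain ⟨hω, hc⟩ := Finset.mem_filter.1 hω
        obtain ⟨hω', hc'⟩ := Finset.mem_filter.1 hω'
        rw [← closeBC_phi3 hbc (hmem ω hω).1 (hiso ω hω hc),
          ← closeBC_phi3 hbc (hmem ω' hω').1 (hiso ω' hω' hc'), heq]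
  calc S.card = (S.filter fun ω => G.Case1 ω a b c).card +
        (S.filter fun ω => ¬ G.Case1 ω a b c).card := hsplit.symm
    _ ≤ _ := add_le_add h1 h2

/-- **Class positivity of `kernel26` on a simple graph with distinct marks whose neighbourhood of
`b` is hub-like.** -/
theorem IsMarkHubGraph.cubeSumQuad_nonneg_of_simple_b [Fintype E] [DecidableEq E]
    (hG : G.IsMarkHubGraph a b c b) (hs : G.IsSimple) (hab : a ≠ b) (hac : a ≠ c) (hbc : b ≠ c) :
    0 ≤ G.cubeSumQuad ![a, b, c] kernel26 := by
  classical
  rw [G.cubeSumQuad_kernel26_nonneg_iff]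
  exact hG.bot3_card_le_b hs hab hac hbc

end BHub

/-! ### The `a ↔ b` symmetry of the family -/

section Swap

variable {a b c : V}

/-- `IsMark` is symmetric in `a`, `b`. -/
theorem IsMark.swap' {x : V} (h : IsMark a b c x) : IsMark b a c x := by
  rcases h with h | h | h
  · exact Or.inr (Or.inl h)
  · exact Or.inl h
  · exact Or.inr (Or.inr h)

/-- `IsHubLike` is symmetric in `a`, `b`. -/
theorem IsHubLike.swap' {x : V} (h : G.IsHubLike a b c x) : G.IsHubLike b a c x :=
  fun f => ⟨fun hf => IsMark.swap' ((h f).1 hf), fun hf => IsMark.swap' ((h f).2 hf)⟩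

/-- `IsMarkHubGraph` is symmetric in `a`, `b`. -/
theorem IsMarkHubGraph.swap' {m : V} (h : G.IsMarkHubGraph a b c m) :
    G.IsMarkHubGraph b a c m := fun f =>
  ⟨fun hf hx => IsHubLike.swap' ((h f).1 hf fun hm => hx (IsMark.swap' hm)),
    fun hf hx => IsHubLike.swap' ((h f).2 hf fun hm => hx (IsMark.swap' hm))⟩

end Swap

end MultiGraph

/-! ### The theorems -/

/-- **The reduced class positivity on the family «the neighbourhood of `b` is hub-like»** — the
hypothesis of p1's `c026_bHub_of_reduced`. -/
theorem bHubFamily_reducedClassPositive : bHubFamily.ReducedClassPositive := by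
  intro V E _ _ _ G a b c hG hs hab hac hbc _
  exact MultiGraph.IsMarkHubGraph.cubeSumQuad_nonneg_of_simple_b hG hs hab hac hbc

/-- **C-026 when the neighbourhood of `b` is hub-like** (mine-3's Theorem″): for every marked
multigraph in which every non-mark neighbour of `b` is adjacent only to the marks (the rest of the
graph arbitrary), every `p ∈ [0,1]^E`: `(x + y₁)(y₁ + z) ≤ y₁ + y₂ + y₃`. -/
theorem c026_bHub {V E : Type} [Fintype V] [Fintype E] [DecidableEq E] (G : MultiGraph V E)
    {a b c : V} (hG : G.IsMarkHubGraph a b c b) (p : E → ℝ) (hp : IsProb p) :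
    (G.law3 p a b c 0 + G.law3 p a b c 1) * (G.law3 p a b c 1 + G.law3 p a b c 4) ≤
      G.law3 p a b c 1 + G.law3 p a b c 2 + G.law3 p a b c 3 :=
  c026_bHub_of_reduced bHubFamily_reducedClassPositive G hG p hp

/-- **C-026 when the neighbourhood of `a` is hub-like**: Theorem″ with the roles of `a` and `b`
exchanged, through the `a ↔ b` symmetry of the rows (`law3_swap`). -/
theorem c026_aHub {V E : Type} [Fintype V] [Fintype E] [DecidableEq E] (G : MultiGraph V E)
    {a b c : V} (hG : G.IsMarkHubGraph a b c a) (p : E → ℝ) (hp : IsProb p) :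
    (G.law3 p a b c 0 + G.law3 p a b c 1) * (G.law3 p a b c 1 + G.law3 p a b c 4) ≤
      G.law3 p a b c 1 + G.law3 p a b c 2 + G.law3 p a b c 3 := by
  have h := c026_bHub G hG.swap' p hp
  obtain ⟨h0, h1, h2, h3, h4⟩ := G.law3_swap p a b c
  rw [h0, h1, h2, h3, h4] at h
  linarith

/-- **C-026 whenever one of the three marks has a hub-like neighbourhood** (mine-3's Theorem′ and
Theorem″ together): every non-mark neighbour of `a`, or of `b`, or of `c`, is adjacent only to the
marks. -/
theorem c026_of_mark_hubLike {V E : Type} [Fintype V] [Fintype E] [DecidableEq E]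
    (G : MultiGraph V E) {a b c : V}
    (hG : G.IsMarkHubGraph a b c a ∨ G.IsMarkHubGraph a b c b ∨ G.IsMarkHubGraph a b c c)
    (p : E → ℝ) (hp : IsProb p) :
    (G.law3 p a b c 0 + G.law3 p a b c 1) * (G.law3 p a b c 1 + G.law3 p a b c 4) ≤
      G.law3 p a b c 1 + G.law3 p a b c 2 + G.law3 p a b c 3 := by
  rcases hG with hG | hG | hG
  · exact c026_aHub G hG p hp
  · exact c026_bHub G hG p hp
  · exact c026_cHub G hG p hp

end PercRepro
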